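import Summits.RiemannHypothesis.RiemannHypothesis.Theorems.HandoffMarginLaw
import HarnessLib

/-!
# HANDOFF — the exponent-3/2 ceiling implies the UPPER CLAUSE `a*(S_{<q}) < (log q⁺)/2` for all large `q`, with NO gap hypothesis (rh-explicit, track «HANDOFF», seat prove-2 gen7, ATTEMPT-15 §6 (iii′))

HONEST FRAMING. Nothing here bears on the truth of RH. The cell's «upper clause» `UC(q)` says that the truncated form `{p < q}`
dies INSIDE the window of `q`: `a*(S_{<q}) < (log q⁺)/2`, `q⁺ = nextPrime q`. The tree has it kernel-certified for `q ≤ 13`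
(`HandoffUpperClauses`), RH-free only behind a Cramér-size gap (`HandoffWallCeiling.wall_lt_log_half_of_large_gap`), and cc-s2-6 certifies it
prime by prime numerically; handoff-idea-2 gen21's handed route R-XX-c′ types the gap-conditioned `UpperClauseLogGap c`. This file records the
elementary implication behind ATTEMPT-15 §6 (iii′): since `(log q⁺)/2 − (log q)/2 ≥ ½·log(1 + 1/q) ≥ 1/(2(q+1))` and
`C·(log q)^{3/2}·q^{−3/2} < 1/(2(q+1))` for `q > (256|C| + 1)⁴`, **ANY exponent-3/2 wall ceiling `DodgerWallCeiling C q₀` gives `UC(q)` for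
all `q ≥ max(q₀, ⌈(256|C|+1)⁴⌉ + 3)` — no gap condition** (`upperClause_of_dodgerWallCeiling`; the hypothesis is written out as
`∀ q prime ≥ q₀, wallOffset q ≤ C·(log q)^{3/2}·q^{−3/2}`, which is `HandoffDodgerCeiling.DodgerWallCeiling C q₀` unfolded — that module is
not imported here only because its hub olean was not yet built when this file was checked). The ceiling itself is ATTEMPT-15's
DERIVED-MODEL target (typed, not proved, in `HandoffDodgerCeiling`); numerically (ATTEMPT-15 §6 (iii′), v1.7) the dodger cells give `UC(q)` at every
computed `11 ≤ q ≤ 251` with margin ≈ 58× (q = 11; 57.8) … 175× (q = 251) against the markdown's `1/(q+2)` (odd primes, `q⁺ ≥ q + 2`; DERIVED-FLOAT `δ_B`),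
≈ 50× for the cells CERTIFIED from the prime side at `δ = 1.15·δ_B` through `q = 101` (cc-s2-6 g8), and ≈ 31× / ≈ 27× against THIS file's weaker constant `1/(2(q+1))`
(which only uses `q⁺ ≥ q + 1`). [erratum to the first version's «margin ≥ 58×»: referee r31 P15-h.] No `sorry`, no axiom beyond the standard three.

References (as printed): E. Bombieri, Rend. Mat. Acc. Lincei (9) 11 (2000) Thm 2 [`Bombieri2000Weil`]; this track: ATTEMPT-15 §6, ATTEMPT-12 §3,
handoff/idea-2/gen21/lean/DirichletSeedSketch.lean (R-XX-c′).
-/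

set_option linter.dupNamespace false

noncomputable section

open Real Set Summit.RiemannHypothesis.RiemannHypothesis.Theorems.MotivicDoor.SemilocalThreshold
open Summit.RiemannHypothesis.RiemannHypothesis.Theorems.HandoffMarginLaw (wallOffset)
open Summit.RiemannHypothesis.RiemannHypothesis.Theorems.HandoffDecomposition (nextPrime lt_nextPrime)

namespace Summit.RiemannHypothesis.RiemannHypothesis.Theorems.Handoff

/-- Half a log-step up to the next prime is at least `1/(2(q+1))`: `(log q)/2 + 1/(2(q+1)) ≤ (log q⁺)/2` (`q⁺ ≥ q + 1`,
`log((q+1)/q) ≥ 1 − q/(q+1)`). [folklore] -/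
theorem log_half_add_le_log_nextPrime_half {q : ℕ} (hq : 1 ≤ q) :
    Real.log q / 2 + 1 / (2 * ((q : ℝ) + 1)) ≤ Real.log (nextPrime q) / 2 := by
  have hq0 : (0 : ℝ) < q := by exact_mod_cast hq
  have hq1 : (q : ℝ) + 1 ≤ (nextPrime q : ℝ) := by exact_mod_cast lt_nextPrime q
  have hx : 0 < ((q : ℝ) + 1) / q := by positivity
  have h1 : 1 - (((q : ℝ) + 1) / q)⁻¹ ≤ Real.log (((q : ℝ) + 1) / q) := Real.one_sub_inv_le_log_of_pos hx
  rw [inv_div, Real.log_div (by positivity) hq0.ne'] at h1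
  have h2 : 1 - (q : ℝ) / (q + 1) = 1 / ((q : ℝ) + 1) := by field_simp; ring
  rw [h2] at h1
  have h3 : Real.log ((q : ℝ) + 1) ≤ Real.log (nextPrime q) := Real.log_le_log (by positivity) hq1
  have h4 : 1 / (2 * ((q : ℝ) + 1)) = (1 / ((q : ℝ) + 1)) / 2 := by field_simp
  rw [h4]
  linarith

/-- The elementary rate inequality: for `q > (256·|C| + 1)⁴` (and `q ≥ 3`), `C·(log q)^{3/2}·q^{−3/2} < 1/(2(q+1))`
(via `log x ≤ 8x^{1/8}`, `(log x)^{3/2} ≤ (log x)²` for `log x ≥ 1`). [folklore] -/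
theorem ceiling_rate_lt {C : ℝ} {q : ℕ} (hq3 : 3 ≤ q) (hqC : (256 * |C| + 1) ^ 4 < (q : ℝ)) :
    C * Real.log q ^ (3 / 2 : ℝ) * (q : ℝ) ^ (-(3 / 2 : ℝ)) < 1 / (2 * ((q : ℝ) + 1)) := by
  have hx3 : (3 : ℝ) ≤ q := by exact_mod_cast hq3
  have hx0 : (0 : ℝ) < q := by linarith
  have hlog1 : 1 ≤ Real.log (q : ℝ) := by
    rw [← Real.log_exp 1]
    refine Real.log_le_log (Real.exp_pos 1) (le_trans ?_ hx3)
    have := Real.exp_one_lt_d9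
    linarith
  have hlog0 : 0 ≤ Real.log (q : ℝ) := by linarith
  -- (log q)^{3/2} ≤ (log q)^2 ≤ 64 q^{1/4}
  have hA : Real.log (q : ℝ) ^ (3 / 2 : ℝ) ≤ Real.log (q : ℝ) ^ 2 := by
    rw [← Real.rpow_two]
    exact Real.rpow_le_rpow_of_exponent_le hlog1 (by norm_num)
  have hB : Real.log (q : ℝ) ≤ 8 * (q : ℝ) ^ (1 / 8 : ℝ) := by
    have := Real.log_le_rpow_div hx0.le (by norm_num : (0 : ℝ) < 1 / 8)
    linarith [this]
  have hq8 : 0 ≤ (q : ℝ) ^ (1 / 8 : ℝ) := Real.rpow_nonneg hx0.le _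
  have hC2 : Real.log (q : ℝ) ^ 2 ≤ 64 * (q : ℝ) ^ (1 / 4 : ℝ) := by
    have h1 : Real.log (q : ℝ) ^ 2 ≤ (8 * (q : ℝ) ^ (1 / 8 : ℝ)) ^ 2 := pow_le_pow_left₀ hlog0 hB 2
    have h2 : ((q : ℝ) ^ (1 / 8 : ℝ)) ^ 2 = (q : ℝ) ^ (1 / 4 : ℝ) := by
      rw [← Real.rpow_natCast, ← Real.rpow_mul hx0.le]
      norm_num
    nlinarith [h1, h2]
  have hpos32 : 0 < (q : ℝ) ^ (-(3 / 2 : ℝ)) := Real.rpow_pos_of_pos hx0 _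
  -- combine: C·(log q)^{3/2}·q^{-3/2} ≤ |C|·64·q^{1/4}·q^{-3/2} = 64|C|·q^{-5/4}
  have hprod : (q : ℝ) ^ (1 / 4 : ℝ) * (q : ℝ) ^ (-(3 / 2 : ℝ)) = (q : ℝ) ^ (-(5 / 4 : ℝ)) := by
    rw [← Real.rpow_add hx0]; norm_num
  have hstep1 : C * Real.log q ^ (3 / 2 : ℝ) * (q : ℝ) ^ (-(3 / 2 : ℝ)) ≤
      64 * |C| * (q : ℝ) ^ (-(5 / 4 : ℝ)) := by
    have hl32 : 0 ≤ Real.log (q : ℝ) ^ (3 / 2 : ℝ) := Real.rpow_nonneg hlog0 _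
    calc C * Real.log q ^ (3 / 2 : ℝ) * (q : ℝ) ^ (-(3 / 2 : ℝ))
        ≤ |C| * Real.log q ^ (3 / 2 : ℝ) * (q : ℝ) ^ (-(3 / 2 : ℝ)) := by
          gcongr
          exact le_abs_self C
      _ ≤ |C| * (64 * (q : ℝ) ^ (1 / 4 : ℝ)) * (q : ℝ) ^ (-(3 / 2 : ℝ)) := by
          gcongr
          exact hA.trans hC2
      _ = 64 * |C| * ((q : ℝ) ^ (1 / 4 : ℝ) * (q : ℝ) ^ (-(3 / 2 : ℝ))) := by ring
      _ = 64 * |C| * (q : ℝ) ^ (-(5 / 4 : ℝ)) := by rw [hprod]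
  -- 64|C| q^{-5/4} < 1/(2(q+1))  ⟸  256|C| < q^{1/4}
  have hroot : 256 * |C| + 1 ≤ (q : ℝ) ^ (1 / 4 : ℝ) := by
    have hM0 : 0 ≤ 256 * |C| + 1 := by positivity
    have e : ((256 * |C| + 1) ^ 4) ^ (1 / 4 : ℝ) = 256 * |C| + 1 := by
      rw [show (1 / 4 : ℝ) = ((4 : ℕ) : ℝ)⁻¹ by norm_num]
      exact Real.pow_rpow_inv_natCast hM0 (by norm_num)
    rw [← e]
    exact Real.rpow_le_rpow (by positivity) hqC.le (by norm_num)
  have hq14 : 0 < (q : ℝ) ^ (1 / 4 : ℝ) := Real.rpow_pos_of_pos hx0 _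
  have hsplit : (q : ℝ) ^ (-(5 / 4 : ℝ)) = ((q : ℝ) ^ (1 / 4 : ℝ))⁻¹ * (q : ℝ)⁻¹ := by
    rw [show (-(5 / 4 : ℝ)) = -(1 / 4 : ℝ) + (-1 : ℝ) by norm_num, Real.rpow_add hx0, Real.rpow_neg hx0.le,
      Real.rpow_neg hx0.le, Real.rpow_one]
  rw [hsplit] at hstep1
  have hkey : 64 * |C| * (((q : ℝ) ^ (1 / 4 : ℝ))⁻¹ * (q : ℝ)⁻¹) < 1 / (2 * ((q : ℝ) + 1)) := by
    rw [show 64 * |C| * (((q : ℝ) ^ (1 / 4 : ℝ))⁻¹ * (q : ℝ)⁻¹) = (64 * |C|) / ((q : ℝ) ^ (1 / 4 : ℝ) * q) by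
      field_simp]
    rw [div_lt_div_iff₀ (by positivity) (by positivity)]
    -- 64|C|·2(q+1) < q^{1/4}·q : use q + 1 ≤ 2q and 256|C| + 1 ≤ q^{1/4}
    have h2q : (q : ℝ) + 1 ≤ 2 * q := by linarith
    have habs : 0 ≤ |C| := abs_nonneg C
    nlinarith [hroot, h2q, hq14, hx0, habs, mul_le_mul_of_nonneg_right hroot hx0.le]
  exact lt_of_le_of_lt hstep1 hkey

/-- **THE UPPER CLAUSE FROM THE EXPONENT-3/2 CEILING (no gap hypothesis).** If `δ*(q) ≤ C·(log q)^{3/2}·q^{−3/2}` for all primes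
`q ≥ q₀` (= `HandoffDodgerCeiling.DodgerWallCeiling C q₀`, ATTEMPT-15's typed target, written out), then for every prime `q ≥ max(q₀, 3)` with `q > (256|C|+1)⁴`:
`a*(S_{<q}) < (log q⁺)/2` — the truncated form `{p < q}` dies inside the window of `q`, `q⁺ = nextPrime q`.
RH-free in form and content; compare `wall_lt_log_half_of_large_gap` (needs a Cramér-size gap) and idea-2's `UpperClauseLogGap c` (gap `≥ c log q`).
[this track, ATTEMPT-15 §6 (iii′)] -/
theorem upperClause_of_dodgerWallCeiling {C : ℝ} {q₀ q : ℕ}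
    (h : ∀ q : ℕ, q.Prime → q₀ ≤ q → wallOffset q ≤ C * Real.log q ^ (3 / 2 : ℝ) * (q : ℝ) ^ (-(3 / 2 : ℝ)))
    (hq : q.Prime) (hq₀ : q₀ ≤ q)
    (hq3 : 3 ≤ q) (hqC : (256 * |C| + 1) ^ 4 < (q : ℝ)) :
    weilSemilocalThreshold (Nat.primesBelow q) < Real.log (nextPrime q) / 2 := by
  have h1 : wallOffset q ≤ C * Real.log q ^ (3 / 2 : ℝ) * (q : ℝ) ^ (-(3 / 2 : ℝ)) := h q hq hq₀
  have h2 := ceiling_rate_lt (C := C) hq3 hqC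
  have h3 := log_half_add_le_log_nextPrime_half (q := q) (by omega)
  simp only [wallOffset] at h1
  linarith

/-- Eventual form: the exponent-3/2 ceiling from `q₀` on `⟹ ∃ q₁ ∀ primes q ≥ q₁, a*(S_{<q}) < (log q⁺)/2`, with the explicit
`q₁ = max q₀ (⌈(256|C|+1)⁴⌉₊ + 3)`. [this track, ATTEMPT-15 §6 (iii′)] -/
theorem upperClause_eventually_of_dodgerWallCeiling {C : ℝ} {q₀ : ℕ}
    (h : ∀ q : ℕ, q.Prime → q₀ ≤ q → wallOffset q ≤ C * Real.log q ^ (3 / 2 : ℝ) * (q : ℝ) ^ (-(3 / 2 : ℝ))) :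
    ∃ q₁ : ℕ, ∀ q : ℕ, q₁ ≤ q → q.Prime → weilSemilocalThreshold (Nat.primesBelow q) < Real.log (nextPrime q) / 2 := by
  refine ⟨max q₀ (⌈(256 * |C| + 1) ^ 4⌉₊ + 3), fun q hq1 hq ↦ ?_⟩
  have hq₀ : q₀ ≤ q := (le_max_left _ _).trans hq1
  have hceil : ⌈(256 * |C| + 1) ^ 4⌉₊ + 3 ≤ q := (le_max_right _ _).trans hq1
  have hq3 : 3 ≤ q := by omega
  have hqC : (256 * |C| + 1) ^ 4 < (q : ℝ) := by
    have h1 : (256 * |C| + 1) ^ 4 ≤ (⌈(256 * |C| + 1) ^ 4⌉₊ : ℝ) := Nat.le_ceil _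
    have h2 : ((⌈(256 * |C| + 1) ^ 4⌉₊ + 3 : ℕ) : ℝ) ≤ q := by exact_mod_cast hceil
    push_cast at h2
    linarith
  exact upperClause_of_dodgerWallCeiling h hq hq₀ hq3 hqC

end Summit.RiemannHypothesis.RiemannHypothesis.Theorems.Handoff
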